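import Literature.NumberTheory.LFunctions.Zhang2022.Section12U030Bookkeeping
import HarnessLib

/-!
# Zhang (2022), rescue GAP/BED (D-0124 (3)(4)(5)): §12 u030 — the second-residue bookkeeping at exponent 15 for the
# SHARP residue core (the product `L′(1,χ)·(1 − ρ̃)` carried as the Lemma 5.8 error `C₅𝓛⁻¹⁵`)

Topic `Literature/NumberTheory/LFunctions/Zhang2022` (Landau–Siegel audit tree; verdict-neutral).
Y. Zhang, *Discrete mean estimates and the Landau–Siegel zero*, arXiv:2211.02515v1 (2022)
[Zhang2022LandauSiegel] — **an unrefereed manuscript under adjudication; nothing in this file asserts or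
denies its Theorems 1–2, and nothing here is a claim about Landau–Siegel zeros. The programme SEARCHES and
TYPES; no claim about Landau–Siegel zeros, Theorems 1–2 of arXiv:2211.02515 or a repaired Margin232 until a
kernel theorem says so.**

Companion of `RepairGapSection12ResidueTwoSharp` (`Lemma84.norm_resTwo_sub_model_le_pow15_sharp`). The tree's bookkeeping
`Lemma84.resTwo_le` needs `δ = 1 − ρ̃ ≤ K_ρ𝓛⁻²⁰²²` (17 suffices: `Repair.Gap.resTwo_le_pow17`) because three of its seven
terms are `ℓ₁·δ`-terms without a factor `α`. In the sharp core those three terms carry `E = C₅𝓛⁻¹⁵` (Lemma 5.8 at `ρ̃`)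
in place of `ℓ₁·δ`; the only bare `δ` left sits in `E′ = 8e^{9/2}(1+𝓛)𝓛²δ`, which comes with `α²` — budget `𝓛³·α·δ`,
fine for `δ ≤ K_ρ𝓛⁻¹⁵`. This file: `resTwo_le_pow15_sharp` — the seven-term bound `≤ C′_{res,2}·𝓛⁻¹⁵Π̂²` under
`δ ≤ K_ρ(𝓛¹⁵)⁻¹`, with `C′_{res,2} = 256πe^πe^{9/2}CK² + 48e^πKC₅ + 256πe^πe^{9/2}K²K_ρ + 32e^πKC₅ + 8e·e^π·πK²C₅ +
8πe^πe^{9/2}K² + 8e^πK²C₅`. Real-variable bookkeeping only; nothing about (A) itself.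

## References

* Y. Zhang, arXiv:2211.02515v1 (2022), §12 p. 70 (proof of Lemma 12.3), §8 proof of Lemma 8.4 p. 47.
  [cite: Zhang2022LandauSiegel, §12 p.70; §8 Lemma 8.4]
-/

noncomputable section

open Real

namespace Literature.NumberTheory.LFunctions.Zhang2022.Repair.Gap

open Literature.NumberTheory.LFunctions.Zhang2022.Lemma84 (pow_mul_inv_pow_le)

/-- **The second residue's error is `O(𝓛⁻¹⁵Π̂²)` for `δ = 1 − ρ̃ ≤ K_ρ𝓛⁻¹⁵` once `L′(1,χ)·δ` is carried as `E = C₅𝓛⁻¹⁵`**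
(bookkeeping for `Lemma84.norm_resTwo_sub_model_le_pow15_sharp`; cf. `Lemma84.resTwo_le`, whose `ℓ₁·δ` terms need
`δ ≤ K_ρ𝓛⁻¹⁷`): with `ℓ₁ = 2e^{9/2}(1+𝓛)𝓛`, `E_U = C𝓛⁻⁸Π̂`, `E = C₅𝓛⁻¹⁵`, `E′ = 8e^{9/2}(1+𝓛)𝓛²δ`, `α = π𝓛⁻⁹`,
`log Y ≤ 𝓛⁹`, `Λ = 𝓛¹⁰⁰`:
`(8e^π/α)(8E_Uℓ₁K²α² + 6Π̂²KαE + 2Π̂²K²α²E′ + 4Π̂²KαE) + Π̂²K²α²e^π((2eE log Y + ℓ₁/(2Λ))(4/α) + E·8/α²) ≤ C′_{res,2}𝓛⁻¹⁵Π̂²`.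
[cite: Zhang2022LandauSiegel, §12 p.70 (proof of Lemma 12.3)] -/
theorem resTwo_le_pow15_sharp {𝓛 hatPi C K C₅ Kρ δ logY α Λ : ℝ} (h𝓛 : 1 ≤ 𝓛) (hPi : 1 ≤ hatPi)
    (hC : 0 ≤ C) (hC₅ : 0 ≤ C₅) (hKρ : 0 ≤ Kρ) (hδ0 : 0 ≤ δ) (hδ : δ ≤ Kρ * (𝓛 ^ 15)⁻¹)
    (hlogY : logY ≤ 𝓛 ^ 9) (hα : α = π / 𝓛 ^ 9) (hΛ : Λ = 𝓛 ^ 100) :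
    8 * Real.exp π / α *
          (8 * (C * (𝓛 ^ 8)⁻¹ * hatPi) * (2 * Real.exp (9 / 2) * (1 + 𝓛) * 𝓛) * K ^ 2 * α ^ 2 +
            6 * hatPi ^ 2 * K * α * (C₅ / 𝓛 ^ 15) +
            2 * hatPi ^ 2 * K ^ 2 * α ^ 2 * (8 * Real.exp (9 / 2) * (1 + 𝓛) * 𝓛 ^ 2 * δ) +
            4 * hatPi ^ 2 * K * α * (C₅ / 𝓛 ^ 15)) +
        hatPi ^ 2 * K ^ 2 * α ^ 2 *
          (Real.exp π *
            ((2 * Real.exp 1 * (C₅ / 𝓛 ^ 15) * logY + (2 * Real.exp (9 / 2) * (1 + 𝓛) * 𝓛) / (2 * Λ)) *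
                (4 / α) +
              (C₅ / 𝓛 ^ 15) * (8 / α ^ 2))) ≤
      (256 * π * Real.exp π * Real.exp (9 / 2) * C * K ^ 2 + 48 * Real.exp π * K * C₅ +
          256 * π * Real.exp π * Real.exp (9 / 2) * K ^ 2 * Kρ + 32 * Real.exp π * K * C₅ +
          8 * Real.exp 1 * Real.exp π * π * K ^ 2 * C₅ +
          8 * π * Real.exp π * Real.exp (9 / 2) * K ^ 2 +
          8 * Real.exp π * K ^ 2 * C₅) * (𝓛 ^ 15)⁻¹ * hatPi ^ 2 := by
  have h𝓛0 : 0 < 𝓛 := by linarith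
  have hα0 : 0 < α := by rw [hα]; positivity
  have hΛ0 : 0 < Λ := by rw [hΛ]; positivity
  have hPi0 : 0 < hatPi := by linarith
  have hPi2 : hatPi ≤ hatPi ^ 2 := by nlinarith
  set ℓ₁ : ℝ := 2 * Real.exp (9 / 2) * (1 + 𝓛) * 𝓛 with hℓ₁
  have hℓ₁le : ℓ₁ ≤ 4 * Real.exp (9 / 2) * 𝓛 ^ 2 := by
    rw [hℓ₁]
    have h1 : (1 + 𝓛) * 𝓛 ≤ 2 * 𝓛 ^ 2 := by nlinarith
    calc 2 * Real.exp (9 / 2) * (1 + 𝓛) * 𝓛 = 2 * Real.exp (9 / 2) * ((1 + 𝓛) * 𝓛) := by ring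
      _ ≤ 2 * Real.exp (9 / 2) * (2 * 𝓛 ^ 2) := by gcongr
      _ = 4 * Real.exp (9 / 2) * 𝓛 ^ 2 := by ring
  have hℓ₁0 : 0 ≤ ℓ₁ := by rw [hℓ₁]; positivity
  set E : ℝ := C₅ / 𝓛 ^ 15 with hEdef
  have hE0 : 0 ≤ E := by positivity
  set W : ℝ := (𝓛 ^ 15)⁻¹ * hatPi ^ 2 with hW
  have hW0 : 0 ≤ W := by positivity
  have hEW : hatPi ^ 2 * E = C₅ * W := by rw [hEdef, hW]; field_simp
  have hE'le : 8 * Real.exp (9 / 2) * (1 + 𝓛) * 𝓛 ^ 2 * δ ≤ 16 * Real.exp (9 / 2) * 𝓛 ^ 3 * δ := by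
    have h1 : (1 + 𝓛) * 𝓛 ^ 2 ≤ 2 * 𝓛 ^ 3 := by nlinarith [pow_pos h𝓛0 2]
    calc 8 * Real.exp (9 / 2) * (1 + 𝓛) * 𝓛 ^ 2 * δ = 8 * Real.exp (9 / 2) * ((1 + 𝓛) * 𝓛 ^ 2) * δ := by
          ring
      _ ≤ 8 * Real.exp (9 / 2) * (2 * 𝓛 ^ 3) * δ := by gcongr
      _ = 16 * Real.exp (9 / 2) * 𝓛 ^ 3 * δ := by ring
  -- expand into seven terms
  have hexpand : 8 * Real.exp π / α *
          (8 * (C * (𝓛 ^ 8)⁻¹ * hatPi) * ℓ₁ * K ^ 2 * α ^ 2 + 6 * hatPi ^ 2 * K * α * E +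
            2 * hatPi ^ 2 * K ^ 2 * α ^ 2 * (8 * Real.exp (9 / 2) * (1 + 𝓛) * 𝓛 ^ 2 * δ) +
            4 * hatPi ^ 2 * K * α * E) +
        hatPi ^ 2 * K ^ 2 * α ^ 2 *
          (Real.exp π * ((2 * Real.exp 1 * E * logY + ℓ₁ / (2 * Λ)) * (4 / α) + E * (8 / α ^ 2))) =
      64 * Real.exp π * C * (𝓛 ^ 8)⁻¹ * hatPi * ℓ₁ * K ^ 2 * α +
        48 * Real.exp π * K * (hatPi ^ 2 * E) +
        16 * Real.exp π * hatPi ^ 2 * K ^ 2 * α * (8 * Real.exp (9 / 2) * (1 + 𝓛) * 𝓛 ^ 2 * δ) +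
        32 * Real.exp π * K * (hatPi ^ 2 * E) +
        8 * Real.exp 1 * Real.exp π * K ^ 2 * α * logY * (hatPi ^ 2 * E) +
        2 * Real.exp π * hatPi ^ 2 * ℓ₁ * K ^ 2 * α / Λ +
        8 * Real.exp π * K ^ 2 * (hatPi ^ 2 * E) := by
    field_simp
    ring
  rw [hexpand, hEW]
  -- powers of `𝓛`
  have hq1 : 𝓛 ^ 2 * (𝓛 ^ 17)⁻¹ ≤ (𝓛 ^ 15)⁻¹ := pow_mul_inv_pow_le h𝓛 (by norm_num)
  have hq3 : 𝓛 ^ 3 * (𝓛 ^ 24)⁻¹ ≤ (𝓛 ^ 15)⁻¹ := pow_mul_inv_pow_le h𝓛 (by norm_num)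
  have hq6 : 𝓛 ^ 2 * (𝓛 ^ 109)⁻¹ ≤ (𝓛 ^ 15)⁻¹ := pow_mul_inv_pow_le h𝓛 (by norm_num)
  -- T1
  have hT1 : 64 * Real.exp π * C * (𝓛 ^ 8)⁻¹ * hatPi * ℓ₁ * K ^ 2 * α ≤
      256 * π * Real.exp π * Real.exp (9 / 2) * C * K ^ 2 * W := by
    calc 64 * Real.exp π * C * (𝓛 ^ 8)⁻¹ * hatPi * ℓ₁ * K ^ 2 * α
        ≤ 64 * Real.exp π * C * (𝓛 ^ 8)⁻¹ * hatPi ^ 2 * (4 * Real.exp (9 / 2) * 𝓛 ^ 2) * K ^ 2 *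
            (π / 𝓛 ^ 9) := by rw [hα]; gcongr
      _ = 256 * π * Real.exp π * Real.exp (9 / 2) * C * K ^ 2 *
            ((𝓛 ^ 2 * (𝓛 ^ 17)⁻¹) * hatPi ^ 2) := by field_simp; ring
      _ ≤ 256 * π * Real.exp π * Real.exp (9 / 2) * C * K ^ 2 * ((𝓛 ^ 15)⁻¹ * hatPi ^ 2) := by
          gcongr
  -- T3
  have hT3 : 16 * Real.exp π * hatPi ^ 2 * K ^ 2 * α * (8 * Real.exp (9 / 2) * (1 + 𝓛) * 𝓛 ^ 2 * δ) ≤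
      256 * π * Real.exp π * Real.exp (9 / 2) * K ^ 2 * Kρ * W := by
    calc 16 * Real.exp π * hatPi ^ 2 * K ^ 2 * α * (8 * Real.exp (9 / 2) * (1 + 𝓛) * 𝓛 ^ 2 * δ)
        ≤ 16 * Real.exp π * hatPi ^ 2 * K ^ 2 * α * (16 * Real.exp (9 / 2) * 𝓛 ^ 3 * δ) := by
          gcongr
      _ ≤ 16 * Real.exp π * hatPi ^ 2 * K ^ 2 * α *
            (16 * Real.exp (9 / 2) * 𝓛 ^ 3 * (Kρ * (𝓛 ^ 15)⁻¹)) := by gcongr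
      _ = 256 * π * Real.exp π * Real.exp (9 / 2) * K ^ 2 * Kρ *
            ((𝓛 ^ 3 * (𝓛 ^ 24)⁻¹) * hatPi ^ 2) := by rw [hα]; field_simp; ring
      _ ≤ 256 * π * Real.exp π * Real.exp (9 / 2) * K ^ 2 * Kρ * ((𝓛 ^ 15)⁻¹ * hatPi ^ 2) := by
          gcongr
  -- T5
  have hT5 : 8 * Real.exp 1 * Real.exp π * K ^ 2 * α * logY * (C₅ * W) ≤
      8 * Real.exp 1 * Real.exp π * π * K ^ 2 * C₅ * W := by
    have hαlog : α * logY ≤ π := by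
      calc α * logY ≤ (π / 𝓛 ^ 9) * 𝓛 ^ 9 := by rw [hα]; gcongr
        _ = π := by field_simp
    have h0 : 0 ≤ 8 * Real.exp 1 * Real.exp π * K ^ 2 * (C₅ * W) := by positivity
    calc 8 * Real.exp 1 * Real.exp π * K ^ 2 * α * logY * (C₅ * W)
        = 8 * Real.exp 1 * Real.exp π * K ^ 2 * (C₅ * W) * (α * logY) := by ring
      _ ≤ 8 * Real.exp 1 * Real.exp π * K ^ 2 * (C₅ * W) * π := mul_le_mul_of_nonneg_left hαlog h0
      _ = 8 * Real.exp 1 * Real.exp π * π * K ^ 2 * C₅ * W := by ring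
  -- T6
  have hT6 : 2 * Real.exp π * hatPi ^ 2 * ℓ₁ * K ^ 2 * α / Λ ≤
      8 * π * Real.exp π * Real.exp (9 / 2) * K ^ 2 * W := by
    rw [hΛ]
    calc 2 * Real.exp π * hatPi ^ 2 * ℓ₁ * K ^ 2 * α / 𝓛 ^ 100
        ≤ 2 * Real.exp π * hatPi ^ 2 * (4 * Real.exp (9 / 2) * 𝓛 ^ 2) * K ^ 2 * (π / 𝓛 ^ 9) /
            𝓛 ^ 100 := by rw [hα]; gcongr
      _ = 8 * π * Real.exp π * Real.exp (9 / 2) * K ^ 2 * ((𝓛 ^ 2 * (𝓛 ^ 109)⁻¹) * hatPi ^ 2) := by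
          field_simp; ring
      _ ≤ 8 * π * Real.exp π * Real.exp (9 / 2) * K ^ 2 * ((𝓛 ^ 15)⁻¹ * hatPi ^ 2) := by gcongr
  have hsum := add_le_add (add_le_add (add_le_add (add_le_add (add_le_add (add_le_add hT1
    (le_refl (48 * Real.exp π * K * (C₅ * W)))) hT3) (le_refl (32 * Real.exp π * K * (C₅ * W)))) hT5) hT6)
    (le_refl (8 * Real.exp π * K ^ 2 * (C₅ * W)))
  refine hsum.trans (le_of_eq ?_)
  rw [hW]; ring

end Literature.NumberTheory.LFunctions.Zhang2022.Repair.Gap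

end
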